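/-
Copyright: h21 programme. Stub-ideation companion (k = 2, GENERATION 4) — NOT a route file, NOT a
Theorems file. Elaboration sanity only: helper SIGNATURES with `sorry`.
-/
import HarnessLib
import Literature.NumberTheory.Automorphic.CDTTheorem712
import Literature.NumberTheory.EllipticCurves.ModFiveCongruenceHesseFamily
import Literature.NumberTheory.EllipticCurves.ModThreeReducibleIffPsi3Root
import Literature.NumberTheory.EllipticCurves.TorsionFrobenius
import Literature.NumberTheory.EllipticCurves.SemistableModPImageReducibleProofs
import Literature.NumberTheory.EllipticCurves.TateCurve.NumberFieldUniformizationTwistedTateJ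
import Literature.NumberTheory.EllipticCurves.MultiplicativeTransvectionPrimeToVProofs
import Literature.NumberTheory.GaloisRepresentations.DecompositionGroupOfCompletion
import Literature.NumberTheory.DiophantineGeometry.MinimalDiscriminant

/-!
# Stub-ideation k = 2, GENERATION 4 (HOME FAMILY 2 — RESHAPE) for `stub_switch` of crux `FreyModularity`

Companion to `STUB-IDEAS-stub_switch-2.md` (gen 4, supersedes gen 3).  Only the helpers that are NEW
or RE-CUT in generation 4 are typed here.  Unchanged and cited by name:
* gen 2 (`STUB_IDEAS_stub_switch_2_Sketch.lean`, ns `…StubSwitchIdeas2G2`): the reshaped target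
  `CuspForcedSource`, the PROVED glue `stubSwitch_of_cuspForcedSource`, `isTorsionGaloisRep_of_congr`,
  G2 `helper_cyclotomic_eq_of_smul_eq`, C2 `helper_lift_simple_root`, L1 `helper_member_multiplicative`,
  R1 `helper_stable_line_of_not_irreducible`, R2 `helper_isogenyCharacter_unramified`,
  R5 `helper_surjective_three_of_irreducible_of_three_dvd`, F1 `congr_member_base`;
* gen 3 (`STUB_IDEAS_stub_switch_2g3_Sketch.lean`, ns `…StubSwitchK2G3`): FIN2
  `helper_neg_on_line_of_add_one_sq`, R× `helper_character_neg_one`.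

GEN-4 RE-CUT (same road — NONSPLIT-CUSP FORCING — every M-sized gen-3 helper split into an S-sized
arithmetic core + glue onto tree lemmas found since):
* (Δe) **simplicity of the cusp root is free**: `Res_λ(𝔇(λ,1), ∂_λ𝔇(λ,1)) = ±2¹³²·3⁶⁶·5²⁵·(c₄³−c₆²)²²`
  (computed, `calc/disc_D.py`), i.e. `𝔇` is separable mod every `q ∤ 30(c₄³−c₆²)`.  Fisher 12.2 is
  now needed only for its FIRST clause `𝔇(ξ_T,3) = 0` (`FisherSyzygeticPentagonRoot`); the `η_T`
  clause, gen-3 C1b and the injective-reduction plumbing are dropped; separability is the named fact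
  `HessePolynomialSeparable` (Fisher 2012 §12: "12/(6−n) singular fibres" at the roots of the degree-12
  form `𝔇`) or a kernel `ring` certificate.
* (Δa) N1 ↦ N1a (level-uniform twisted-Tate shape `(σ−ε)² = 0`, ONE `ε` for all levels `n`) + N1b
  (`ε = −1` read on `E[5]`, pure algebra).
* (Δb) R4 ↦ R4a (Kronecker–Weber glue, tree `Mazur1978.exists_comp_modNCyclotomicCharacter_eq`) +
  R4b (unramified at `p` ⇒ `β` kills the `p`-component, tree
  `exists_mem_inertia_modNCyclotomicCharacter_eq`) + R4c–e (pure `(ℤ/n)ˣ` lemmas; unramifiedness is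
  needed ONLY at primes `p ∤ m`, because `8·∏_{p∈T₀} p ∣ m` and the target has exponent `2`).
* (Δc) G1 ↦ G1a (pure `GL₂(𝔽₅)`: `−1 ∈ ⁅G,G⁆`) + G1b glue, all of whose inputs are in the tree.
* (Δf) L3+L4 = tree PROVED `dvd_card_range_galoisRepTorsion_of_hasMultiplicativeReductionAt_of_not_dvd`;
  G3 = tree PROVED `modNCyclotomicCharacter_eq_residueCard_of_isArithFrobAt`; R3 in local form.
-/

set_option linter.dupNamespace false
set_option linter.unusedVariables false

noncomputable section

open scoped NumberField
open Literature.NumberTheory.EllipticCurves Literature.NumberTheory.EllipticCurves.HesseFamilyFive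
open Literature.NumberTheory.Automorphic Literature.NumberTheory.GaloisRepresentations
open Literature.NumberTheory.Automorphic.BCDT WeierstrassCurve Field NumberField IsDedekindDomain Matrix

namespace Summit.ABC.ABC.Cruxes.FreyModularity.StubSwitchK2G4

/-- Member `E_{l,m}` of Fisher's direct `5`-congruence family of `y² = x³ − 27c₄x − 54c₆`. -/
abbrev member (c₄ c₆ l m : ℚ) : WeierstrassCurve ℚ :=
  ⟨0, 0, 0, -27 * C4 c₄ c₆ l m, -54 * C6 c₄ c₆ l m⟩

/-- The `c₄c₆`-model (= the member at `(l:m) = (1:0)`). -/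
abbrev base (c₄ c₆ : ℚ) : WeierstrassCurve ℚ := ⟨0, 0, 0, -27 * c₄, -54 * c₆⟩

/-! ## (G) a Galois element that is `−1` on `W[5]` and fixes `μ_m` -/

/-- **G1a (S/M−, pure finite group theory in `GL₂(𝔽₅)`, NEW CUT).**  `G ≤ GL₂(𝔽₅)` with `det G = 𝔽₅ˣ`,
`H ≤ G` with `det(H)² = 1`, `H` without a common `𝔽₅`-eigenline and non-abelian ⇒ `−1 ∈ ⁅G,G⁆`.
Plan: `K = ⁅G,G⁆ ≤ SL₂(𝔽₅)` (`Abelianization.commutator_subset_ker det`).  `|K|` even ⇒ an involution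
of `SL₂(𝔽₅)`, which is `−1` (Cayley–Hamilton: `g² = 1, det g = 1 ⇒ tr(g)·g = 2`).  `|K|` odd ⇒
`|K| ∈ {1,3,5}` (`|K| ∣ 120`; no element of order `15`): `K = 1` ⇒ `G` abelian ⊇ `H` ✗;
`K = ⟨u⟩ ≅ C₅` ⇒ `u` unipotent, `ker(u−1)` a `G`-stable line ✗; `K = ⟨s⟩ ≅ C₃` ⇒ `A = C_G(s) ⊆ 𝔽₅[s]ˣ`
abelian of index `2`, `a³` scalar for `a ∈ A` so `det A ⊆ {±1}`, hence `G ∩ det⁻¹{±1} = A ⊇ H` ✗. -/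
def NegOneMemCommutator : Prop :=
  ∀ (G H : Subgroup (GL (Fin 2) (ZMod 5))), H ≤ G →
    (∀ d : (ZMod 5)ˣ, ∃ g ∈ G, Matrix.GeneralLinearGroup.det g = d) →
    (∀ h ∈ H, Matrix.GeneralLinearGroup.det h ^ 2 = 1) →
    (∀ w : Fin 2 → ZMod 5, w ≠ 0 → ∃ h ∈ H, ∀ c : ZMod 5,
      (h : Matrix (Fin 2) (Fin 2) (ZMod 5)) *ᵥ w ≠ c • w) →
    (∃ h₁ ∈ H, ∃ h₂ ∈ H, h₁ * h₂ ≠ h₂ * h₁) →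
    (-1 : GL (Fin 2) (ZMod 5)) ∈ ⁅G, G⁆

theorem helper_neg_one_mem_commutator : NegOneMemCommutator := by
  sorry

/-- the involution lemma used in G1a (S−; Cayley–Hamilton in characteristic `≠ 2`). -/
theorem helper_involution_SL2_F5 (g : GL (Fin 2) (ZMod 5)) (hdet : Matrix.GeneralLinearGroup.det g = 1)
    (h2 : g * g = 1) : g = 1 ∨ g = -1 := by
  sorry

/-- **G1 = G1b glue (S): gen-2 `helper_exists_neg_one_fixing_cyclotomic` from G1a.**  `G = range ρ̄`,
`H = ρ̄(Γ_{ℚ(√5)})`: `det ρ̄ = χ̄₅` onto (`det_eq_modPCyclotomicCharacter_of_isTorsionGaloisRep_holds`,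
`modNCyclotomicCharacter_rat_surjective`), `χ̄₅² = 1` on `Γ_{ℚ(√5)}`
(Theorems PROVED `sq_modPCyclotomicCharacter_eq_one_of_mem_range`), no `H`-eigenline
(`exists_not_eigenline_of_isAbsolutelyIrreducible`, `f = id`), `H` non-abelian
(`FramedRep.exists_mul_ne_mul_of_isAbsolutelyIrreducible`); then `−1 = ρ̄(σ)` with `σ ∈ ⁅Γ_ℚ,Γ_ℚ⁆`
(`Subgroup.map_commutator`) and `χ̄_m(σ) = 1` (`Abelianization.commutator_subset_ker`).
Honours `Disproof.switch_false_without_det` (the determinant is used, via `hdet`). -/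
theorem helper_exists_neg_one_fixing_cyclotomic (hG : NegOneMemCommutator) (W : WeierstrassCurve ℚ)
    [W.IsElliptic] (ρ : ModPGaloisRep ℚ (ZMod 5) 2) (hρ : W.IsTorsionGaloisRep 5 ρ)
    (hirr : ρ.IsAbsIrreducibleOverSqrt 5) (m : ℕ) [NeZero m] :
    ∃ σ : absoluteGaloisGroup ℚ, (∀ P : W.geomTorsion 5, σ • P = -P) ∧
      modNCyclotomicCharacter ℚ m σ = 1 := by
  sorry

/-- **G3 (S−, now a corollary of the tree's PROVED `modNCyclotomicCharacter_eq_residueCard_of_isArithFrobAt`):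
`χ̄_n(Frob_q) = q`.**  Gives both `q ≡ 1 (mod M)` (from `χ̄_M(φ) = 1`) and `χ̄₃(φ) = χ̄₅(φ) = 1`
(from `15 ∣ M`). -/
theorem helper_cyclotomic_frob_eq (n : ℕ) [NeZero n] {q : ℕ} (hq : q.Prime) (hqn : ¬ q ∣ n)
    {v : HeightOneSpectrum (𝓞 ℚ)} (hv : (Rat.HeightOneSpectrum.primesEquiv v : ℕ) = q)
    {𝔓 : Ideal (absIntegers (𝓞 ℚ) ℚ)} (h𝔓 : 𝔓 ∈ v.primesAbove)
    {φ : absoluteGaloisGroup ℚ} (hφ : IsArithFrobAt (𝓞 ℚ) φ 𝔓) :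
    ((modNCyclotomicCharacter ℚ n φ : (ZMod n)ˣ) : ZMod n) = (q : ZMod n) := by
  sorry

/-! ## (N) the twisted-Tate dictionary, level-uniform -/

/-- **N1a `helper_twistedTate_shape` (M−, NEW CUT; Silverman ATAEC V.5.3 in the tree's currency).**
`E/ℚ` multiplicative at `v`, `σ ∈ D_𝔓` (`𝔓 ∣ v`).  There is ONE sign `ε ∈ {±1}` such that for EVERY
level `n` with `χ̄_n(σ) = 1`: `(σ − ε)² = 0` on `E[n]`.  Plan: conjugate `𝔓` to `adicCompletionPrime v`
(`exists_smul_eq_of_mem_primesAbove_holds`; statement conjugation-stable with the same `ε`), so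
`σ = res σᵥ` (`decompositionSubgroup_adicCompletionPrime_eq_range`); `Ψ` from
`exists_twistedTateUniformisation_tateJ` (PROVED): `σᵥ•Ψ(u) = ε(σᵥ)Ψ(σᵥu)`, `ε(σᵥ) = ±1` by the sign of
`σᵥ t / t`; for `Ψ(u) ∈ E[n]`, `uⁿ ∈ q^ℤ` so `σᵥu = ζu`, `ζ ∈ μ_n`, whence `(σ−ε)Ψ(u) = εΨ(ζ)` and
`(σ−ε)Ψ(ζ) = ε(χ̄_n(σ)−1)Ψ(ζ) = 0`.  Transport `E(ℚ̄)[n] ≅ E(ℚ̄ᵥ)[n]`: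
`exists_pointsMapOfEmb_eq_of_nsmul_eq_zero`, `pointsMap_smul`, `pointsMapOfEmb_injective` (pattern:
tree `exists_unipotent_of_hasMultiplicativeReductionAt`). -/
theorem helper_twistedTate_shape (E : WeierstrassCurve ℚ) [E.IsElliptic]
    {v : HeightOneSpectrum (𝓞 ℚ)} (hmult : E.HasMultiplicativeReductionAt v)
    {𝔓 : Ideal (absIntegers (𝓞 ℚ) ℚ)} (h𝔓 : 𝔓 ∈ v.primesAbove)
    {σ : absoluteGaloisGroup ℚ} (hσ : σ ∈ 𝔓.decompositionSubgroup (absoluteGaloisGroup ℚ)) :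
    ∃ ε : ℤ, (ε = 1 ∨ ε = -1) ∧ ∀ (n : ℕ) [NeZero n], modNCyclotomicCharacter ℚ n σ = 1 →
      ∀ Q : E.geomTorsion n, σ • (σ • Q - ε • Q) = ε • (σ • Q - ε • Q) := by
  sorry

/-- **N1b (S, pure algebra): the sign is read on `E[5]`.**  If `σ = −1` on `E[5] ≠ 0` and
`(σ−ε)² = 0` there, then `ε = −1` (`ε = 1` would give `4P = 0`). -/
theorem helper_eps_eq_neg_one (E : WeierstrassCurve ℚ) [E.IsElliptic] {σ : absoluteGaloisGroup ℚ}
    {ε : ℤ} (hε : ε = 1 ∨ ε = -1) (hneg : ∀ P : E.geomTorsion 5, σ • P = -P)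
    (hshape : ∀ Q : E.geomTorsion 5, σ • (σ • Q - ε • Q) = ε • (σ • Q - ε • Q)) : ε = -1 := by
  sorry

/-- **Frobenius lies in the decomposition group** (S−; Mathlib `IsArithFrobAt`: `φ(𝔓) = 𝔓`). -/
theorem helper_frob_mem_decompositionSubgroup {𝔓 : Ideal (absIntegers (𝓞 ℚ) ℚ)}
    {φ : absoluteGaloisGroup ℚ} (hφ : IsArithFrobAt (𝓞 ℚ) φ 𝔓) :
    φ ∈ 𝔓.decompositionSubgroup (absoluteGaloisGroup ℚ) := by
  sorry

/-- **N1 (S glue of N1a + N1b + G3): gen-3 `helper_frob_add_one_sq_three`'s conclusion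
`(φ+1)² = 0` on `E[3]`.** -/
theorem helper_frob_add_one_sq_three (E : WeierstrassCurve ℚ) [E.IsElliptic] {q : ℕ} (hq : q.Prime)
    (hq15 : q % 15 = 1) {v : HeightOneSpectrum (𝓞 ℚ)}
    (hv : (Rat.HeightOneSpectrum.primesEquiv v : ℕ) = q) (hmult : E.HasMultiplicativeReductionAt v)
    {𝔓 : Ideal (absIntegers (𝓞 ℚ) ℚ)} (h𝔓 : 𝔓 ∈ v.primesAbove)
    {φ : absoluteGaloisGroup ℚ} (hφ : IsArithFrobAt (𝓞 ℚ) φ 𝔓)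
    (hneg : ∀ P : E.geomTorsion 5, φ • P = -P) :
    ∀ Q : E.geomTorsion 3, φ • (φ • Q + Q) + (φ • Q + Q) = 0 := by
  sorry

/-! ## (C) the cusp root mod `q` -/

/-- **[Fisher2012Hessian, Thm. 12.2 (n = 5), first clause] as a `Prop` (named fact, statement-only;
gen-3 `FisherSyzygeticPentagon` with the `η_T` clause dropped).**  For `E : y² = x³ − 27c₄x − 54c₆`,
`T = (x₁,y₁)` of order `5`, `2T = (x₂,y₂)`, `ζ` a primitive `5`-th root of unity:
`𝔇(c₄,c₆; (1+ζ+ζ⁴)x₁ + (1+ζ²+ζ³)x₂, 3) = 0`. -/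
def FisherSyzygeticPentagonRoot : Prop :=
  ∀ (c₄ c₆ : ℚ) (ζ x₁ y₁ x₂ y₂ : AlgebraicClosure ℚ)
    (h₁ : ((base c₄ c₆).baseChange (AlgebraicClosure ℚ)).toAffine.Nonsingular x₁ y₁)
    (h₂ : ((base c₄ c₆).baseChange (AlgebraicClosure ℚ)).toAffine.Nonsingular x₂ y₂)
    (T : (base c₄ c₆).geomTorsion 5),
    c₄ ^ 3 ≠ c₆ ^ 2 → IsPrimitiveRoot ζ 5 → (T : geomPoints (base c₄ c₆)) ≠ 0 →
    (T : geomPoints (base c₄ c₆)) = Affine.Point.some x₁ y₁ h₁ →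
    ((T + T : (base c₄ c₆).geomTorsion 5) : geomPoints (base c₄ c₆)) = Affine.Point.some x₂ y₂ h₂ →
    D (algebraMap ℚ (AlgebraicClosure ℚ) c₄) (algebraMap ℚ (AlgebraicClosure ℚ) c₆)
        ((1 + ζ + ζ ^ 4) * x₁ + (1 + ζ ^ 2 + ζ ^ 3) * x₂) 3 = 0

/-- **[Fisher2012Hessian §2 p.4 ("char ∤ 6n") + §12 p.17 ("12/(6−n) singular fibres … at the roots of
𝔇") + Rem. 8.6] as a `Prop` (named fact, statement-only): the degree-12 Hesse polynomial of a
non-singular model is SEPARABLE in characteristic `∤ 30`.**  Numerical corroboration (this seat):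
`Res_λ(𝔇(λ,1),∂_λ𝔇(λ,1)) = ±2¹³²3⁶⁶5²⁵(c₄³−c₆²)²²`; certifiable in-kernel by a Bézout identity
`U𝔇 + V∂_λ𝔇 = 2^a3^b5^c(c₄³−c₆²)^k` (`ring`). -/
def HessePolynomialSeparable : Prop :=
  ∀ (F : Type) [Field F], (30 : F) ≠ 0 → ∀ c₄ c₆ r : F, c₄ ^ 3 ≠ c₆ ^ 2 →
    D c₄ c₆ r 1 = 0 → Dl c₄ c₆ r 1 ≠ 0

/-- homogeneity of `𝔇` (degree `12`; S−, `ring`). -/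
theorem helper_D_smul {R : Type*} [CommRing R] (c₄ c₆ t l m : R) :
    D c₄ c₆ (t * l) (t * m) = t ^ 12 * D c₄ c₆ l m := by
  simp only [D]; ring

/-- `𝔇` commutes with ring maps (S−). -/
theorem helper_map_D {R S : Type*} [CommRing R] [CommRing S] (f : R →+* S) (c₄ c₆ l m : R) :
    f (D c₄ c₆ l m) = D (f c₄) (f c₆) (f l) (f m) := by
  simp only [D, map_add, map_sub, map_mul, map_pow, map_ofNat]

/-- **C1-i (S, NEW CUT): a Frobenius-fixed algebraic integer is congruent to a rational integer
mod `𝔓`** (`φ A ≡ A^q (mod 𝔓)` and `φ A = A` put `Ā` in the prime field `𝔽_q ⊆ \bar ℤ/𝔓`). -/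
theorem helper_exists_int_congr_of_frob_fixed {q : ℕ} (hq : q.Prime)
    {v : HeightOneSpectrum (𝓞 ℚ)} (hv : (Rat.HeightOneSpectrum.primesEquiv v : ℕ) = q)
    {𝔓 : Ideal (absIntegers (𝓞 ℚ) ℚ)} (h𝔓 : 𝔓 ∈ v.primesAbove)
    {φ : absoluteGaloisGroup ℚ} (hφ : IsArithFrobAt (𝓞 ℚ) φ 𝔓)
    (A : absIntegers (𝓞 ℚ) ℚ) (hA : φ • A = A) : ∃ a : ℤ, A - a ∈ 𝔓 := by
  sorry

/-- **C1a `helper_D_root_mod_q` (M−, RE-CUT of gen-3 C1): Frobenius `= −1` on `E[5]`, `q ≡ 1 (5)` ⇒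
`𝔇_E(λ,1)` has a root mod `q`.**  Plan: `T ∈ E[5]∖0`, `T = (x₁,y₁)`, `2T = (x₂,y₂)`; `5x₁, 5x₂ ∈ \bar ℤ`
(roots of `ΨSq₅ = (preΨ'₅)²`, leading coefficient `5`: `zsmul_some_eq_zero_iff_eval_ΨSq`,
`isIntegral_leadingCoeff_smul`); `φ` fixes `x₁, x₂` (`φT = −T`) and `ζ₅`
(`IsArithFrobAt.apply_of_pow_eq_one`, `q ≡ 1 (5)`), hence `A := 5ξ_T`; C1-i gives `a : ℤ` with
`A ≡ a (𝔓)`; `𝔇(A,15) = 5¹²𝔇(ξ_T,3) = 0` (`FisherSyzygeticPentagonRoot`, `helper_D_smul`), so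
`q ∣ 𝔇(a,15)` (`helper_map_D`, `𝔓 ∩ ℤ = (q)`), and `r := a·15⁻¹ (mod q)`. -/
theorem helper_D_root_mod_q (hF : FisherSyzygeticPentagonRoot) (c₄ c₆ : ℤ) (hΔ : c₄ ^ 3 ≠ c₆ ^ 2)
    [hE : (base (c₄ : ℚ) (c₆ : ℚ)).IsElliptic]
    {q : ℕ} (hq : q.Prime) (hq15 : ¬ q ∣ 15) (hq5 : q % 5 = 1)
    {v : HeightOneSpectrum (𝓞 ℚ)} (hv : (Rat.HeightOneSpectrum.primesEquiv v : ℕ) = q)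
    {𝔓 : Ideal (absIntegers (𝓞 ℚ) ℚ)} (h𝔓 : 𝔓 ∈ v.primesAbove)
    {φ : absoluteGaloisGroup ℚ} (hφ : IsArithFrobAt (𝓞 ℚ) φ 𝔓)
    (hneg : ∀ P : (base (c₄ : ℚ) (c₆ : ℚ)).geomTorsion 5, φ • P = -P) :
    ∃ r : ℤ, (q : ℤ) ∣ D c₄ c₆ r 1 := by
  sorry

/-- **C1s (S): simplicity from separability** (cast to `ZMod q`: `30 ≠ 0`, `c₄³ ≠ c₆²` there since
`q ∤ 30(c₄³−c₆²)`; `helper_map_D` for `Int.castRingHom`; `ZMod.intCast_zmod_eq_zero_iff_dvd`). -/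
theorem helper_simple_root_of_separable (hS : HessePolynomialSeparable) (c₄ c₆ r : ℤ)
    {q : ℕ} (hq : q.Prime) (hq30 : ¬ (q : ℤ) ∣ 30 * (c₄ ^ 3 - c₆ ^ 2))
    (hr : (q : ℤ) ∣ D c₄ c₆ r 1) : ¬ (q : ℤ) ∣ Dl c₄ c₆ r 1 := by
  sorry

/-! ## (R) the reducible case: local form of R3 and the split of R4 -/

/-- **R3 (S, local RE-CUT of gen-2 `helper_not_additive_transfer`): non-additive reduction at `v ∤ 5`
transfers along a `5`-congruence** (`exists_ne_zero_smul_eq_of_not_hasAdditiveReductionAt` at `ℓ = 5`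
on `W`, transport the inertia-fixed point through `Congr`, then
`smul_eq_zero_of_hasAdditiveReductionAt_of_mem_primesAbove` (`ℓ = 5 > 4`) on `E`). -/
theorem helper_not_additive_of_congr (W E : WeierstrassCurve ℚ) [W.IsElliptic] [E.IsElliptic]
    (h : Congr E W) {v : HeightOneSpectrum (𝓞 ℚ)} (h5v : ((5 : ℕ) : 𝓞 ℚ) ∉ v.asIdeal)
    (hW : ¬ W.HasAdditiveReductionAt v) : ¬ E.HasAdditiveReductionAt v := by
  sorry

/-- **R4e (S−): `a ≡ 1 (mod p)` ⇒ `a^{p^k} ≡ 1 (mod p^{k+1})`.** -/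
theorem helper_pow_prime_pow_congr_one {p : ℕ} (hp : p.Prime) (k : ℕ) {a : ℤ}
    (ha : a ≡ 1 [ZMOD p]) : a ^ p ^ k ≡ 1 [ZMOD (p : ℤ) ^ (k + 1)] := by
  sorry

/-- **R4d (S−): `a ≡ 1 (mod 8)` ⇒ `a` is a square mod `2^e`** (Hensel at `2`, induction on `e`). -/
theorem helper_sq_congr_of_one_mod_eight (e : ℕ) {a : ℤ} (ha : a ≡ 1 [ZMOD 8]) :
    ∃ x : ℤ, x ^ 2 ≡ a [ZMOD (2 : ℤ) ^ e] := by
  sorry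

/-- **R4c (S/M−, pure `(ℤ/n)ˣ`, NEW CUT — the key bookkeeping insight).**  `M` of exponent `2`,
`8 ∣ m ∣ n`, `β : (ℤ/n)ˣ → M` trivial on the full `p`-component `ker((ℤ/n)ˣ → (ℤ/(n/p^{v_p n}))ˣ)` for
every prime `p ∣ n` with `p ∤ m` ⇒ `β` is trivial on `ker((ℤ/n)ˣ → (ℤ/m)ˣ)`.  (CRT: an element of the
kernel is `≡ 1 (mod m)`; its components at `p ∤ m` die by hypothesis, at odd `p ∣ m` they have
`p`-power order (R4e) and die in the exponent-`2` group, at `p = 2` they are `≡ 1 (mod 8)` hence squares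
(R4d).)  No unramifiedness at the primes of `m` is ever needed. -/
theorem helper_ker_unitsMap_le_ker {n m : ℕ} [NeZero n] (hmn : m ∣ n) (h8 : 8 ∣ m)
    {M : Type*} [CommGroup M] (hM : ∀ x : M, x ^ 2 = 1) (β : (ZMod n)ˣ →* M)
    (hβ : ∀ p : ℕ, p.Prime → p ∣ n → ¬ p ∣ m →
      ∀ a : (ZMod n)ˣ, ZMod.unitsMap (Nat.ordCompl_dvd n p) a = 1 → β a = 1)
    (a : (ZMod n)ˣ) (ha : ZMod.unitsMap hmn a = 1) : β a = 1 := by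
  sorry

/-- **R4b (S): unramified at `p` ⇒ `β` kills the `p`-component** (if `p ∤ n` the component is trivial;
else `n = p^{k+1}·d`, `p ∤ d`, and the tree's `exists_mem_inertia_modNCyclotomicCharacter_eq` produces
`τ ∈ I_𝔓` with `χ̄_n(τ) = a`, so `β a = ψ τ = 1`; `Rat.HeightOneSpectrum.natGenerator v = p` there is
this `primesEquiv` hypothesis). -/
theorem helper_beta_eq_one_of_unramified {M : Type*} [CommGroup M] (ψ : absoluteGaloisGroup ℚ →* M)
    {n : ℕ} [NeZero n] (β : (ZMod n)ˣ →* M)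
    (hβ : ∀ σ : absoluteGaloisGroup ℚ, β (modNCyclotomicCharacter ℚ n σ) = ψ σ)
    {p : ℕ} (hp : p.Prime) {v : HeightOneSpectrum (𝓞 ℚ)}
    (hv : (Rat.HeightOneSpectrum.primesEquiv v : ℕ) = p)
    (hunr : ∀ 𝔓 ∈ v.primesAbove, ∀ τ ∈ 𝔓.inertia (absoluteGaloisGroup ℚ), ψ τ = 1)
    (a : (ZMod n)ˣ) (ha : ZMod.unitsMap (Nat.ordCompl_dvd n p) a = 1) : β a = 1 := by
  sorry

/-- **R4 = R4a glue (S given R4b, R4c): gen-2 `helper_quadratic_character_cyclotomic` with the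
unramifiedness hypothesis WEAKENED to the primes not dividing `m`.**  KW (`exists_comp_modNCyclotomicCharacter_eq`)
gives `ψ = β₀ ∘ χ̄_{n₀}`; pass to `n = n₀m` (`unitsMap_modNCyclotomicCharacter`), apply R4b at every
`p ∣ n`, `p ∤ m`, then R4c to `a = χ̄_n(σ)` (`unitsMap a = χ̄_m(σ) = 1`). -/
theorem helper_quadratic_character_cyclotomic {M : Type*} [CommGroup M] (hM : ∀ x : M, x ^ 2 = 1)
    (ψ : absoluteGaloisGroup ℚ →* M)
    (hker : IsOpen ((ψ.ker : Subgroup (absoluteGaloisGroup ℚ)) : Set (absoluteGaloisGroup ℚ)))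
    {m : ℕ} [NeZero m] (h8 : 8 ∣ m)
    (hunr : ∀ (v : HeightOneSpectrum (𝓞 ℚ)), ¬ (Rat.HeightOneSpectrum.primesEquiv v : ℕ) ∣ m →
      ∀ 𝔓 ∈ v.primesAbove, ∀ τ ∈ 𝔓.inertia (absoluteGaloisGroup ℚ), ψ τ = 1)
    (σ : absoluteGaloisGroup ℚ) (hσ : modNCyclotomicCharacter ℚ m σ = 1) : ψ σ = 1 := by
  sorry

/-! ## (L) `3 ∣ #im ρ̄_{E,3}` is the tree's PROVED
`WeierstrassCurve.dvd_card_range_galoisRepTorsion_of_hasMultiplicativeReductionAt_of_not_dvd`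
(`p = 3`, `ordMinimalDiscriminant v = 5` from gen-2 L1) — no helper. -/

/-- sanity: the tree lemma has the shape the assembly consumes. -/
example (E : WeierstrassCurve ℚ) [E.IsElliptic] {v : HeightOneSpectrum (𝓞 ℚ)}
    (hmult : E.HasMultiplicativeReductionAt v) (h3v : ((3 : ℕ) : 𝓞 ℚ) ∉ v.asIdeal)
    (h5 : E.ordMinimalDiscriminant v = 5) :
    3 ∣ Nat.card (galoisRepTorsion E ((3 : ℕ) : ℤ)).range :=
  E.dvd_card_range_galoisRepTorsion_of_hasMultiplicativeReductionAt_of_not_dvd hmult Nat.prime_three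
    h3v (by rw [h5]; decide)

end Summit.ABC.ABC.Cruxes.FreyModularity.StubSwitchK2G4
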